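import Summits.BirchSwinnertonDyer.BirchSwinnertonDyer.Theorems.ManinLocalTwoThreeHeckeThetaTwentySeven
import Literature.NumberTheory.DiophantineGeometry.GeneralizedFermatTwoPowerCoefficientExponentThree
import HarnessLib

/-!
# The Größencharakter of `36a1` over `ℚ(ω)`: primary generators modulo `2λ = (2 − 2ω)` (norm `12`), and Hecke's theta
# series of weight `2` on `Γ₀(36)` — FACT-FREE
(route `ManinLocalTwoThree`, cruxes C2 `ManinOddAtFour` stmt-22967 / C3 `ManinPrimeToThreeAtNine` stmt-22968 at `N = 36 = 4·9`;
cell bsd-f2-manin, prover seat p2 gen 26; level-`36` twin of -an g48 / p3 g22's `HeckeThetaTwentySeven` §1–§4 (modulus `(3)`, level `27`))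

Toward the fact-free NON-VACUITY of the `X₀(36)`-domain on which `LigozatIdentitiesThirtySix.abs_maninConstant_eq_one_thirtySix`
proves `|c| = 1`: the curve `36a1 : y² = x³ + 1` has CM by `ℤ[ω]` and conductor `36 = |d_K| · N(𝔪)` with `𝔪 = 2λ = (2 − 2ω)`,
`N(𝔪) = 12`.  The unit group `μ₆ = {±1, ±ω, ±ω²}` maps ISOMORPHICALLY onto `(ℤ[ω]/2λ)ˣ ≅ 𝔽₄ˣ × 𝔽₃ˣ`, so every ideal prime to
`6` has a unique generator `ϖ′ ≡ 1 (mod 2λ)` and `𝔭 ↦ e(ϖ′_𝔭)` is a Größencharakter modulo `2λ` of type `(1, 0)` — by the tree's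
general `isGrossencharakter_primaryGen`.  Everything here is assembled from PROVED tree theorems; no named fact, no definition
(the modulus is spelled `Ideal.span {mkInt 2 (-2)}`), no sorry.

* §1 the modulus: `a + bω ∈ (2 − 2ω) ⟺ 2 ∣ a, 2 ∣ b, 6 ∣ a + b` (`mem_span_iff`); `N = 12`; `12 ∈ 𝔪`; level `3 · 12 = 36`.
* §2 `hinj36` (a unit `≡ 1 (mod 2λ)` is `1`) and `hsurj36` (every `x` prime to `2λ` has a unit multiple `≡ 1 (mod 2λ)`, by the
  six-case table `±1` for `a` odd `b` even, `±ω²` for `a` even `b` odd, `±ω` for `a, b` odd, the sign fixed by `a + b (mod 3)`).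
* §3 (H0) `isGrossencharakter_psi36`; (H2) trivial Nebentypus `ψ̃((n)) = χ₋₃(n) · n` for odd `n` prime to `36` (`nebentypus36`).
* §4 (H1) Hecke's theta series (tree `HeckeTheta.heckeThetaCuspForm_of_isGrossencharakter` at `K3`, `k = 2`, `𝔪 = 2λ`): **a cusp form
  `g ∈ S₂(Γ₀(36))` with `aₙ(g) = Σ_{N𝔞 = n, (𝔞, 6) = 1} e(ϖ′_𝔞)`** (`exists_heckeTheta_thirtySix`).
The identification `aₙ(g) = aₙ(36a1)` (cubic reciprocity at the prime `2`: `(4/ϖ)₃ ϖ = ϖ′`) and `g = η(6τ)⁴` are the sequel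
`…HeckeThetaThirtySix`.  Nothing here proves C2, C3, Manin's conjecture or BSD.
[cite: Hecke1926Modulfunktionen] [cite: Ribet1977Nebentypus, §3] [cite: IrelandRosen1990, Ch. 9 §3 Prop. 9.3.5, Ch. 18 §7] [cite: CremonaAlgorithms1997, Table 1 (36a1)]
-/

set_option autoImplicit false
-- lint-debt: the directory name repeats the summit name (sibling precedent `ManinLocalTwoThreeHeckeThetaTwentySeven.lean`)
set_option linter.dupNamespace false

noncomputable section

open scoped Classical ComplexConjugate MatrixGroups UpperHalfPlane ModularForm Real
open Complex NumberField IsDedekindDomain Finset CongruenceSubgroup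
open Literature.NumberTheory.NumberFields Literature.NumberTheory.NumberFields.K3
open Literature.NumberTheory.GaloisRepresentations
open Literature.NumberTheory.LFunctions Literature.NumberTheory.LFunctions.NumberField
open Literature.NumberTheory.LFunctions.EisensteinGrossen
open Literature.NumberTheory.EllipticCurves Literature.NumberTheory.EllipticCurves.ModularForms

namespace Summit.BirchSwinnertonDyer.BirchSwinnertonDyer.Theorems.ManinLocalTwoThree.HeckeCharacterThirtySix

/-! ## §1 The modulus `2λ = (2 − 2ω)` of norm `12` -/

/-- `(2 − 2ω)(c + dω) = (2c + 2d) + (4d − 2c)ω`. [folklore] -/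
theorem mkInt_two_neg_two_mul (c d : ℤ) : mkInt 2 (-2) * mkInt c d = mkInt (2 * c + 2 * d) (4 * d - 2 * c) := by
  rw [mkInt_mul]; congr 1 <;> ring

/-- **Membership in `(2 − 2ω)`**: `a + bω ∈ (2 − 2ω) ⟺ 2 ∣ a ∧ 2 ∣ b ∧ 6 ∣ a + b`. [cite: IrelandRosen1990, Ch. 9 §1] -/
theorem mem_span_iff (a b : ℤ) : mkInt a b ∈ Ideal.span {mkInt 2 (-2)} ↔ 2 ∣ a ∧ 2 ∣ b ∧ 6 ∣ a + b := by
  rw [Ideal.mem_span_singleton]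
  constructor
  · rintro ⟨y, hy⟩
    obtain ⟨c, d, rfl⟩ := exists_eq_mkInt y
    rw [mkInt_two_neg_two_mul, mkInt_inj] at hy
    omega
  · rintro ⟨⟨a', ha⟩, ⟨b', hb⟩, ⟨e, he⟩⟩
    exact ⟨mkInt (a' - e) e, by rw [mkInt_two_neg_two_mul, mkInt_inj]; omega⟩

/-- `1 = mkInt 1 0`, `mkInt a b − 1 = mkInt (a − 1) b`. [folklore] -/
theorem mkInt_sub_one (a b : ℤ) : mkInt a b - 1 = mkInt (a - 1) b := by
  rw [sub_eq_iff_eq_add, show (1 : 𝓞 K3) = mkInt 1 0 by rw [mkInt_intCast, Int.cast_one], mkInt_add]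
  congr 1 <;> ring

/-- `N(2 − 2ω) = 12`. [folklore] -/
theorem absNorm_span : Ideal.absNorm (Ideal.span {mkInt 2 (-2)}) = 12 := by
  rw [absNorm_span_mkInt]; norm_num

/-- `(2 − 2ω) ≠ 0`. [folklore] -/
theorem span_ne_bot : Ideal.span {mkInt 2 (-2)} ≠ ⊥ := by
  rw [Ne, Ideal.span_singleton_eq_bot, mkInt_eq_zero_iff]; omega

/-- `12 ∈ (2 − 2ω)` (indeed `(2 − 2ω)² = (12)`). [folklore] -/
theorem twelve_mem_span : ((12 : ℕ) : 𝓞 K3) ∈ Ideal.span {mkInt 2 (-2)} := by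
  rw [show ((12 : ℕ) : 𝓞 K3) = mkInt 12 0 by rw [mkInt_intCast]; norm_cast, mem_span_iff]; omega

/-- The level `|d_K| · N(2λ) = 3 · 12 = 36`. [cite: Ribet1977Nebentypus, §3] -/
theorem level_thirtySix : (NumberField.discr K3).natAbs * Ideal.absNorm (Ideal.span {mkInt 2 (-2)}) = 36 := by
  rw [KubertTateEisensteinTwist.discr_K3, absNorm_span]; rfl

/-! ## §2 The units of `ℤ[ω]` modulo `2λ`: `μ₆ ≅ (ℤ[ω]/2λ)ˣ` -/

-- `ω(a + bω) = −b + (a − b)ω` is the tree's `Literature.NumberTheory.Literature.NumberTheory.DiophantineGeometry.zetaInt_mul_mkInt` (not restated).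

/-- `ω²(a + bω) = (b − a) − aω`. [folklore] -/
theorem zetaInt_sq_mul_mkInt (a b : ℤ) : zetaInt ^ 2 * mkInt a b = mkInt (b - a) (-a) := by
  rw [sq, mul_assoc, Literature.NumberTheory.DiophantineGeometry.zetaInt_mul_mkInt, Literature.NumberTheory.DiophantineGeometry.zetaInt_mul_mkInt]; congr 1 <;> ring

/-- **`hinj36`: a unit `u ≡ 1 (mod 2λ)` is `1`** (`N(u) = 1` forces `u = a + bω` with `|a|, |b| ≤ 1`; `2 ∣ b`, `6 ∣ a − 1 + b` leave `u = 1`).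
[cite: IrelandRosen1990, Ch. 9 §3 Prop. 9.3.5] -/
theorem hinj36 : ∀ u : (𝓞 K3)ˣ, (u : 𝓞 K3) - 1 ∈ Ideal.span {mkInt 2 (-2)} → u = 1 := by
  intro u hu
  obtain ⟨a, b, hab⟩ := exists_eq_mkInt (u : 𝓞 K3)
  have hN : a ^ 2 - a * b + b ^ 2 = 1 := norm_eq_one_of_isUnit (hab ▸ u.isUnit)
  rw [hab, mkInt_sub_one, mem_span_iff] at hu
  obtain ⟨h1, h2, h3⟩ := hu
  have hb2 : b ^ 2 ≤ 1 := by nlinarith [sq_nonneg (2 * a - b)]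
  have hbb : -1 ≤ b ∧ b ≤ 1 := by constructor <;> nlinarith
  have ha2 : a ^ 2 ≤ 1 := by nlinarith [sq_nonneg (2 * b - a)]
  have hab' : -1 ≤ a ∧ a ≤ 1 := by constructor <;> nlinarith
  obtain ⟨hb0, hb1⟩ := hbb
  obtain ⟨ha0, ha1⟩ := hab'
  have hb : b = 0 := by interval_cases b <;> omega
  subst hb
  have ha : a = 1 := by interval_cases a <;> omega
  subst ha
  apply Units.ext
  rw [Units.val_one, hab, mkInt_intCast, Int.cast_one]

/-- Mod-`2` obstruction: if `2 ∣ a` and `2 ∣ b` then `a + bω` is not prime to `2λ`. [folklore] -/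
theorem key_mod_two : ∀ p q a b c d : ZMod 2,
    p * (2 * a) - q * (2 * b) + (c * 2 - d * (-2)) ≠ 1 := by decide

/-- Mod-`3` obstruction: if `3 ∣ a + b` then `a + bω` is not prime to `2λ` (reduction modulo `λ`: `a + bω ↦ a + b`). [folklore] -/
theorem key_mod_three : ∀ p q a b c d t : ZMod 3, a + b = 3 * t →
    p * a - q * b + (c * 2 - d * (-2)) = 1 → p * b + q * a - q * b + (c * (-2) + d * 2 - d * (-2)) = 0 → False := by
  decide

/-- **`hsurj36`: every `x ∈ ℤ[ω]` prime to `2λ` has a unit multiple `≡ 1 (mod 2λ)`** (table: `±1` for `a` odd `b` even, `±ω²` for `a` even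
`b` odd, `±ω` for `a, b` odd; the sign is fixed by `a + b (mod 3)`). [cite: IrelandRosen1990, Ch. 9 §3 Prop. 9.3.5] -/
theorem hsurj36 : ∀ x : 𝓞 K3, IsCoprime (Ideal.span {x}) (Ideal.span {mkInt 2 (-2)}) →
    ∃ u : (𝓞 K3)ˣ, (u : 𝓞 K3) * x - 1 ∈ Ideal.span {mkInt 2 (-2)} := by
  intro x hx
  obtain ⟨a, b, rfl⟩ := exists_eq_mkInt x
  rw [Ideal.isCoprime_span_singleton_iff] at hx
  obtain ⟨r, s, hrs⟩ := hx
  obtain ⟨p, q, rfl⟩ := exists_eq_mkInt r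
  obtain ⟨c, d, rfl⟩ := exists_eq_mkInt s
  rw [mkInt_mul, mkInt_mul, mkInt_add, ← Int.cast_one (R := 𝓞 K3), ← mkInt_intCast, mkInt_inj] at hrs
  obtain ⟨e1, e2⟩ := hrs
  -- the two obstructions
  have hodd : ¬ (2 ∣ a ∧ 2 ∣ b) := by
    rintro ⟨⟨a', rfl⟩, ⟨b', rfl⟩⟩
    have h := congrArg (fun z : ℤ ↦ (z : ZMod 2)) e1
    push_cast at h
    exact key_mod_two _ _ _ _ _ _ h
  have h3 : ¬ (3 : ℤ) ∣ a + b := by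
    rintro ⟨t, ht⟩
    have h1' := congrArg (fun z : ℤ ↦ (z : ZMod 3)) e1
    have h2' := congrArg (fun z : ℤ ↦ (z : ZMod 3)) e2
    have ht' := congrArg (fun z : ℤ ↦ (z : ZMod 3)) ht
    push_cast at h1' h2' ht'
    exact key_mod_three _ _ _ _ _ _ _ ht' h1' h2'
  have hζu : IsUnit (zetaInt : 𝓞 K3) := hζ.isUnit (by norm_num)
  have hz1 : ((hζu.unit : (𝓞 K3)ˣ) : 𝓞 K3) = zetaInt := IsUnit.unit_spec hζu
  -- the table
  rcases Int.emod_two_eq_zero_or_one a with ha | ha <;> rcases Int.emod_two_eq_zero_or_one b with hb | hb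
  · exact absurd ⟨Int.dvd_of_emod_eq_zero ha, Int.dvd_of_emod_eq_zero hb⟩ hodd
  · -- `a` even, `b` odd: `±ω²`
    by_cases hs : (a + b) % 3 = 1
    · refine ⟨hζu.unit ^ 2, ?_⟩
      rw [Units.val_pow_eq_pow_val, hz1, zetaInt_sq_mul_mkInt, mkInt_sub_one, mem_span_iff]; omega
    · refine ⟨-(hζu.unit ^ 2), ?_⟩
      rw [Units.val_neg, Units.val_pow_eq_pow_val, hz1, neg_mul, zetaInt_sq_mul_mkInt, neg_mkInt, mkInt_sub_one,
        mem_span_iff]; omega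
  · -- `a` odd, `b` even: `±1`
    by_cases hs : (a + b) % 3 = 1
    · exact ⟨1, by rw [Units.val_one, one_mul, mkInt_sub_one, mem_span_iff]; omega⟩
    · exact ⟨-1, by rw [Units.val_neg, Units.val_one, neg_one_mul, neg_mkInt, mkInt_sub_one, mem_span_iff]; omega⟩
  · -- `a, b` odd: `±ω`
    by_cases hs : (a + b) % 3 = 1
    · refine ⟨hζu.unit, ?_⟩
      rw [hz1, Literature.NumberTheory.DiophantineGeometry.zetaInt_mul_mkInt, mkInt_sub_one, mem_span_iff]; omega
    · refine ⟨-hζu.unit, ?_⟩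
      rw [Units.val_neg, hz1, neg_mul, Literature.NumberTheory.DiophantineGeometry.zetaInt_mul_mkInt, neg_mkInt, mkInt_sub_one, mem_span_iff]; omega

/-! ## §3 The Größencharakter (H0) and its Nebentypus (H2) -/

/-- **H0 (PROVED): the CM Größencharakter of `36a`**, `𝔭 ↦ e(ϖ′_𝔭)` with `ϖ′_𝔭 ≡ 1 (mod 2λ)` the primary generator (`𝔭 ∤ 6`), is a
Größencharakter modulo `2λ` of type `(embType e, embTypeConj e)`. [cite: Hecke1926Modulfunktionen] [cite: IrelandRosen1990, Ch. 18 §7] -/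
theorem isGrossencharakter_psi36 :
    IsGrossencharakter (Ideal.span {mkInt 2 (-2)}) (embType (embC : K3 →ₐ[ℚ] ℂ).toRingHom) (embTypeConj (embC : K3 →ₐ[ℚ] ℂ).toRingHom)
      (fun v ↦ (embC : K3 →ₐ[ℚ] ℂ).toRingHom (primaryGen hsurj36 v)) :=
  isGrossencharakter_primaryGen hsurj36 hinj36 span_ne_bot _

/-- `(n) + 2λ = 1` in `ℤ[ω]` for `n` prime to `12`. [folklore] -/
theorem isCoprime_span_natCast {n : ℕ} (hn : n.Coprime 12) :
    IsCoprime (Ideal.span {(n : 𝓞 K3)}) (Ideal.span {mkInt 2 (-2)}) := by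
  have h12 : IsCoprime (Ideal.span {(n : 𝓞 K3)}) (Ideal.span {((12 : ℕ) : 𝓞 K3)}) := by
    rw [Ideal.isCoprime_span_singleton_iff]
    have h : IsCoprime ((n : ℕ) : ℤ) ((12 : ℕ) : ℤ) := Nat.isCoprime_iff_coprime.mpr hn
    simpa using h.map (Int.castRingHom (𝓞 K3))
  exact isCoprime_of_le h12 ((Ideal.span_singleton_le_iff_mem _).mpr twelve_mem_span)

/-- `primarize n = n` or `−n` according as `n ≡ 1, 2 (mod 3)`, for `n` prime to `12`. [cite: IrelandRosen1990, Ch. 9 §3] -/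
theorem primarize_natCast {n : ℕ} (hn : n.Coprime 12) :
    primarize hsurj36 (n : 𝓞 K3) = if n % 3 = 1 then (n : 𝓞 K3) else -(n : 𝓞 K3) := by
  have hcop := isCoprime_span_natCast hn
  have h2 : n % 2 = 1 := by
    by_contra h; have : 2 ∣ Nat.gcd n 12 := Nat.dvd_gcd (by omega) (by norm_num); rw [hn] at this; omega
  have h3 : n % 3 ≠ 0 := by
    intro h; have : 3 ∣ Nat.gcd n 12 := Nat.dvd_gcd (by omega) (by norm_num); rw [hn] at this; omega
  have hcast : (n : 𝓞 K3) = mkInt n 0 := by rw [mkInt_intCast]; norm_cast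
  split_ifs with h
  · refine primarize_eq_of hsurj36 hinj36 hcop rfl ?_
    rw [hcast, mkInt_sub_one, mem_span_iff]; omega
  · refine primarize_eq_of hsurj36 hinj36 hcop (Ideal.span_singleton_neg (n : 𝓞 K3)) ?_
    rw [hcast, neg_mkInt, mkInt_sub_one, mem_span_iff]; omega

/-- **H2 (PROVED): trivial Nebentypus** — `ψ̃((n)) = χ₋₃(n) · n` for odd `n` prime to `36`. [cite: Ribet1977Nebentypus, §3] -/
theorem nebentypus36 (n : ℕ) (hn : Odd n) (hc : n.Coprime 36) :
    idealPow K3 (fun v ↦ (embC : K3 →ₐ[ℚ] ℂ).toRingHom (primaryGen hsurj36 v)) (Ideal.span {(n : 𝓞 K3)}) =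
      (jacobiSym (-3) n : ℂ) * (n : ℂ) := by
  have h12 : n.Coprime 12 := Nat.Coprime.coprime_dvd_right (by norm_num : 12 ∣ 36) hc
  have h3 : ¬ 3 ∣ n := by
    intro h
    have h9 : (3 : ℕ) ∣ Nat.gcd n 36 := Nat.dvd_gcd h (by norm_num)
    rw [hc] at h9
    exact absurd h9 (by norm_num)
  have hn0 : (n : 𝓞 K3) ≠ 0 := by
    have : n ≠ 0 := by rintro rfl; exact h3 (dvd_zero 3)
    exact_mod_cast this
  have hcop := isCoprime_span_natCast h12
  have h := idealPow_primaryGen_span hsurj36 hinj36 span_ne_bot (embC : K3 →ₐ[ℚ] ℂ).toRingHom hn0 hcop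
  rw [show idealPow K3 (fun v ↦ (embC : K3 →ₐ[ℚ] ℂ).toRingHom (primaryGen hsurj36 v)) (Ideal.span {(n : 𝓞 K3)}) =
      (embC : K3 →ₐ[ℚ] ℂ).toRingHom (primarize hsurj36 (n : 𝓞 K3)) from h,
    primarize_natCast h12, HeckeThetaTwentySeven.jacobiSym_neg_three_eq hn h3]
  split_ifs <;> simp

/-! ## §4 Hecke's theta series of weight `2` on `Γ₀(36)` (H1, K1) -/

/-- Transport of a `q`-series presentation along propositional equalities of level and weight. [folklore] -/
theorem transportLevel {L : ℕ} {k : ℤ} (hL : L = 36) (hk : k = 2) (c : ℕ → ℂ) (g : CuspForm (Gamma0 L) k)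
    (hg : ∀ τ : ℍ, HasSum (fun n : ℕ ↦ c n * cexp (2 * π * I * (τ : ℂ)) ^ n) (g τ)) :
    ∃ g' : CuspForm (Gamma0 36) 2, ∀ τ : ℍ, HasSum (fun n : ℕ ↦ c n * cexp (2 * π * I * (τ : ℂ)) ^ n) (g' τ) := by
  subst hL hk; exact ⟨g, hg⟩

/-- **H1 (PROVED, tree theorem `HeckeTheta.heckeThetaCuspForm_of_isGrossencharakter` at `K3`, `k = 2`, `𝔪 = 2λ`)**: Hecke's theta series
`Σ_{(𝔞,6)=1} ψ̃(𝔞) q^{N𝔞}` is a weight-`2` cusp form on `Γ₀(36)`. [cite: Hecke1926Modulfunktionen] [cite: Ribet1977Nebentypus, §3] -/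
theorem exists_heckeTheta36_hasSum :
    ∃ g : CuspForm (Gamma0 36) 2, ∀ τ : ℍ,
      HasSum (fun n : ℕ ↦ (∑ᶠ J ∈ {J : Ideal (𝓞 K3) | Ideal.absNorm J = n},
        rayClassCoeff (Ideal.span {mkInt 2 (-2)}) (fun v ↦ (embC : K3 →ₐ[ℚ] ℂ).toRingHom (primaryGen hsurj36 v)) J) *
        cexp (2 * π * I * (τ : ℂ)) ^ n) (g τ) := by
  have hG : IsGrossencharakter (Ideal.span {mkInt 2 (-2)}) (fun w ↦ (((2 : ℕ) : ℤ) - 1) * embType (embC : K3 →ₐ[ℚ] ℂ).toRingHom w)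
      (fun w ↦ (((2 : ℕ) : ℤ) - 1) * embTypeConj (embC : K3 →ₐ[ℚ] ℂ).toRingHom w)
      (fun v ↦ (embC : K3 →ₐ[ℚ] ℂ).toRingHom (primaryGen hsurj36 v)) := by
    have e1 : (fun w ↦ (((2 : ℕ) : ℤ) - 1) * embType (embC : K3 →ₐ[ℚ] ℂ).toRingHom w) = embType (embC : K3 →ₐ[ℚ] ℂ).toRingHom :=
      funext fun w ↦ by norm_num
    have e2 : (fun w ↦ (((2 : ℕ) : ℤ) - 1) * embTypeConj (embC : K3 →ₐ[ℚ] ℂ).toRingHom w) =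
        embTypeConj (embC : K3 →ₐ[ℚ] ℂ).toRingHom :=
      funext fun w ↦ by norm_num
    rw [e1, e2]; exact isGrossencharakter_psi36
  have hneb : ∀ n : ℕ, Odd n → n.Coprime ((discr K3).natAbs * Ideal.absNorm (Ideal.span {mkInt 2 (-2)})) →
      idealPow K3 (fun v ↦ (embC : K3 →ₐ[ℚ] ℂ).toRingHom (primaryGen hsurj36 v)) (Ideal.span {(n : 𝓞 K3)}) =
        (jacobiSym (discr K3) n : ℂ) * (n : ℂ) ^ (2 - 1) := by
    intro n hn hc
    rw [level_thirtySix] at hc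
    rw [KubertTateEisensteinTwist.discr_K3, show (2 : ℕ) - 1 = 1 from rfl, pow_one]
    exact nebentypus36 n hn hc
  obtain ⟨g, hg⟩ := Literature.NumberTheory.EllipticCurves.ModularForms.HeckeTheta.heckeThetaCuspForm_of_isGrossencharakter
    K3 K3.finrank_eq HeckeThetaTwentySeven.isTotallyComplex_K3 (embC : K3 →ₐ[ℚ] ℂ).toRingHom 2 le_rfl even_two
    (Ideal.span {mkInt 2 (-2)}) span_ne_bot _ hG hneb
  exact transportLevel level_thirtySix (by norm_num) _ g hg

/-- Fourier coefficients of a form on `Γ₀(36)` from a `q`-series `HasSum`. [folklore] -/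
theorem cuspCoeff_eq_of_hasSum_thirtySix (g : CuspForm (Gamma0 36) 2) (c : ℕ → ℂ)
    (hg : ∀ τ : ℍ, HasSum (fun n : ℕ ↦ c n * cexp (2 * π * I * (τ : ℂ)) ^ n) (g τ)) (n : ℕ) :
    cuspCoeff g n = c n := by
  show (UpperHalfPlane.qExpansion 1 ⇑g).coeff n = c n
  refine Literature.NumberTheory.ModularForms.qExpansion_coeff_eq_of_hasSum (c := c)
    (SlashInvariantFormClass.periodic_comp_ofComplex g (one_mem_strictPeriods_Gamma0 (N := 36)))
    (ModularFormClass.holo g) (ModularFormClass.bdd_at_infty g) (fun τ ↦ ?_) n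
  refine (hg τ).congr_fun fun m ↦ ?_
  rw [smul_eq_mul, Function.Periodic.qParam]
  congr 2
  push_cast
  ring_nf

/-- **K1 PROVED (fact-free): Hecke's theta series of `ℚ(ω)` mod `2λ` is a cusp form of weight `2` on `Γ₀(36)` with
`aₙ = Σ_{N𝔞 = n} (ray-class coefficient)`.** [cite: Hecke1926Modulfunktionen] [cite: Ribet1977Nebentypus, §3] -/
theorem exists_heckeTheta_thirtySix :
    ∃ g : CuspForm (Gamma0 36) 2, ∀ n : ℕ, cuspCoeff g n =
      ∑ᶠ J ∈ {J : Ideal (𝓞 K3) | Ideal.absNorm J = n},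
        rayClassCoeff (Ideal.span {mkInt 2 (-2)}) (fun v ↦ (embC : K3 →ₐ[ℚ] ℂ).toRingHom (primaryGen hsurj36 v)) J := by
  obtain ⟨g, hg⟩ := exists_heckeTheta36_hasSum
  exact ⟨g, fun n ↦ cuspCoeff_eq_of_hasSum_thirtySix g _ hg n⟩

end Summit.BirchSwinnertonDyer.BirchSwinnertonDyer.Theorems.ManinLocalTwoThree.HeckeCharacterThirtySix

end
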